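import Summits.HodgeConjecture.HodgeConjecture.Theorems.R90S6IndexSeparatesU2        -- ★ W8-e `mem_orbit_of_ncard_orbit_eq_two`
import Literature.NumberTheory.Automorphic.UnitaryLatticeTreeValencyInertPlace      -- ★ V5: the residual binders discharged at an inert place

/-!
# R90 · S6 (Rogawski Ch. 14.1–5, stable trace formula) — W8-e′: THE PAYER `hsep` AT AN INERT PLACE, `N = 2`
# (`Theorems/R90S6IndexSeparatesU2Inert.lean`; the index `#(K₀ g K₀ ∕ K₀)` separates the `K₀`-double cosets of `U(σ_w, antidiag(1,1))(E_w)`)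

Helper for the S6 floor sockets `R90.S6.StubR90ExtE1HeckeFL` (the `eH`-binder: `U(Φ₂)_w`-factor of `H_v`) ∕ `R90.S6.StubR90ExtE1TwistedTransferFL`
(`Cruxes/H413/Lines/R90_S6_FloorE1D.lean`), DAG r5 row E1.3.9.1; the `N = 2` twin of ★ W8-c′ `R90.S6.mem_orbit_of_ncard_orbit_eq_inert`
[Theorems/R90S6IndexSeparatesU3Inert].  At an INERT place `w ∣ v` (`c • w = w`, `c ≠ 1`) of a quadratic extension `E ∕ F` of number fields with `v` unramified in `E`,
for the local Galois involution `σ_w = galAdicCompletionMap c hw` of `E_w` and ANY uniformiser `ϖ` carrying the unramified datum (one exists: ★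
`UnitaryGroup.unramifiedLocalConjDatum_adicCompletion`), the abstract ★ W8-e `R90.S6.mem_orbit_of_ncard_orbit_eq_two` applies: its residual binders are discharged by
★ V5 [UnitaryLatticeTreeValencyInertPlace] — `hσO` (★ `galAdicCompletionMap_mem_valuedInteger`), `σk`∕`hσk` (★ `exists_residueField_ringHom_of_v_eq`), `|𝓀[E_w]| = q_v²`
(★ `fintypeCard_valuedResidueField_eq_sq_of_inert`), `σ̄_w = Frob_{q_v}` (★ `residueHom_galAdicCompletionMap_eq_pow_valued`).

Cell `hodgecm-mathlib`, crux H413 (`stmt-HodgeConjecture-24833`), route of record `HCCMUnconditional`; programme R90-TF (brief `director/R90-BRIEF.v2.md`),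
section S6 (base `R90-C14`), seat R90-C14-p02 (g2) (S6 dealer R90-C14-plan (g2) 2026-09-04T23:58:41Z: «(A.5)∕(A.6) N = 2 twins … `hsep` ≔ ★ W8-e»).  Lane
`--supports stmt-HodgeConjecture-24833 --as helper`; ONE theorem, no definition, no `sorry`, no instance, no notation; imports ★ Theorems + ★ Literature only
(never Lines).  HONEST LABEL: a helper theorem, count-neutral until the E1.3.9 ∕ E1.4.4.5a assemblies consume it; HC_CM is proved only modulo the 7 printed
citations (2 remaining named inputs: hLiu418 = stmt-HodgeConjecture-24832, h413 = stmt-HodgeConjecture-24833) until rung 0 closes.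

## References
* [BruhatTits1972] F. Bruhat, J. Tits, *Groupes réductifs sur un corps local I*, Publ. Math. IHÉS 41 (1972), (4.4.3), (4.4.4).
* [NeukirchANT1999] J. Neukirch, *Algebraic Number Theory* (1999), Ch. II §4 Prop. (4.3) (unramified local extensions ↔ residue extensions; Frobenius).
* [Serre1980Trees] J.-P. Serre, *Trees* (1980), II.1.1.
-/

set_option autoImplicit false
-- the mandated namespace repeats the single-problem summit's segment (`HodgeConjecture.HodgeConjecture`)
set_option linter.dupNamespace false

noncomputable section

open scoped Valued WithZero Matrix MatrixGroups

open Literature.NumberTheory.Automorphic Literature.NumberTheory.Automorphic.HermitianLattice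
  Literature.NumberTheory.Automorphic.UnitaryLatticeTree

namespace Summit.HodgeConjecture.HodgeConjecture.R90.S6

section InertPlace

open _root_.NumberField _root_.IsDedekindDomain Literature.NumberTheory.Automorphic.UnitaryGroup

variable {F E : Type} [Field F] [NumberField F] [Field E] [NumberField E] [Algebra F E] [Algebra.IsQuadraticExtension F E]
  (c : E ≃ₐ[F] E) (v : HeightOneSpectrum (𝓞 F))

/-- **W8-e′: THE INDEX OF A DOUBLE COSET SEPARATES THE `K₀`-DOUBLE COSETS OF `U(σ_w, antidiag(1,1))(E_w)` AT AN INERT PLACE.**  For a quadratic extension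
`E ∕ F` of number fields, `c ∈ Gal(E∕F)`, `c ≠ 1`, a finite place `v` of `F` unramified in `E` and `w ∣ v` with `c • w = w` (so `v` is inert), the local
involution `σ_w` of `E_w` and any uniformiser `ϖ` with `UnramifiedLocalConjDatum σ_w ϖ`: if two cosets `g K₀`, `g′ K₀` of the hyperspecial
`K₀ = U(σ_w, J₀) ∩ GL₂(𝒪_w)` have `K₀`-orbits of the same size in `U ∕ K₀`, then `g′ K₀ ∈ K₀ · g K₀` — ★ W8-e `mem_orbit_of_ncard_orbit_eq_two` with its
residual binders (`σ_w 𝒪_w ⊆ 𝒪_w`, a reduction `σ̄_w`, `|𝓀[E_w]| = q_v²`, `σ̄_w = Frob_{q_v}`) discharged by ★ V5 `UnitaryLatticeTreeValencyInertPlace`.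
[cite: BruhatTits1972, (4.4.3), (4.4.4)] [cite: NeukirchANT1999, Ch. II §4 Prop. (4.3)] [cite: Serre1980Trees, II.1.1] -/
theorem mem_orbit_of_ncard_orbit_eq_two_inert (hc : c ≠ 1) (hv : Algebra.IsUnramifiedIn (𝓞 E) v.asIdeal) (w : UnitaryGroup.PlacesOver E v)
    (hw : c • w.1 = w.1) {ϖ : w.1.adicCompletion E} (hd : UnramifiedLocalConjDatum (galAdicCompletionMap (L := E) c hw) ϖ)
    (g g' : ↥(unitaryGroupOfForm (galAdicCompletionMap (L := E) c hw) ((StdForm.antidiagonal 2).over (w.1.adicCompletion E))))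
    (h : (MulAction.orbit (unitaryInt (galAdicCompletionMap (L := E) c hw) ((StdForm.antidiagonal 2).over (w.1.adicCompletion E)))
          (g : ↥(unitaryGroupOfForm (galAdicCompletionMap (L := E) c hw) ((StdForm.antidiagonal 2).over (w.1.adicCompletion E))) ⧸
            unitaryInt (galAdicCompletionMap (L := E) c hw) ((StdForm.antidiagonal 2).over (w.1.adicCompletion E)))).ncard =
        (MulAction.orbit (unitaryInt (galAdicCompletionMap (L := E) c hw) ((StdForm.antidiagonal 2).over (w.1.adicCompletion E)))
          (g' : ↥(unitaryGroupOfForm (galAdicCompletionMap (L := E) c hw) ((StdForm.antidiagonal 2).over (w.1.adicCompletion E))) ⧸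
            unitaryInt (galAdicCompletionMap (L := E) c hw) ((StdForm.antidiagonal 2).over (w.1.adicCompletion E)))).ncard) :
    (g' : ↥(unitaryGroupOfForm (galAdicCompletionMap (L := E) c hw) ((StdForm.antidiagonal 2).over (w.1.adicCompletion E))) ⧸
        unitaryInt (galAdicCompletionMap (L := E) c hw) ((StdForm.antidiagonal 2).over (w.1.adicCompletion E))) ∈
      MulAction.orbit (unitaryInt (galAdicCompletionMap (L := E) c hw) ((StdForm.antidiagonal 2).over (w.1.adicCompletion E)))
        (g : ↥(unitaryGroupOfForm (galAdicCompletionMap (L := E) c hw) ((StdForm.antidiagonal 2).over (w.1.adicCompletion E))) ⧸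
          unitaryInt (galAdicCompletionMap (L := E) c hw) ((StdForm.antidiagonal 2).over (w.1.adicCompletion E))) := by
  letI : Fintype 𝓀[w.1.adicCompletion E] := Fintype.ofFinite _
  obtain ⟨σk, hσk⟩ := exists_residueField_ringHom_of_v_eq (K := w.1.adicCompletion E) (fun y => valued_galAdicCompletionMap (L := E) c hw y)
  exact mem_orbit_of_ncard_orbit_eq_two hd (galAdicCompletionMap_mem_valuedInteger c v w hw) σk hσk
    (fintypeCard_valuedResidueField_eq_sq_of_inert c v hc hv w hw) (residueHom_galAdicCompletionMap_eq_pow_valued c v hc hv w hw σk hσk) g g' h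

end InertPlace

end Summit.HodgeConjecture.HodgeConjecture.R90.S6

end
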